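import Summits.Ventures.YMGap.RobustBall.StarBoundaryDecayZd
import Literature.Probability.LatticeModels.DobrushinShlosmanKernelGeometric
import HarnessLib

/-!
# Venture YMGap, track DS (seat ds-3) — «C-KMIX-STAR», boundary half, GEOMETRIC RATE: a finite volume forgets its
# boundary field at rate `ρ^{depth/(D+2)}` through the `ℤ^d` vertex-star doors; `SU(2)`, `d = 4`, every `0 ≤ β_W ≤ 9/25`

HONEST FRAMING. WHAT THIS IS: a venture file (cell `pub-ymgap`, track DS, seat ds-3; theorems only, no `def`, no named
fact). `StarBoundaryDecayZd.lean` runs the star doors through the Literature's kernel boundary-insensitivity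
theorem at the Dobrushin–Shlosman three-zone rate `starRate d ρ = (1−ρ)²/(2(4dρ+1))`, which is what the AVERAGED window
condition affords. The doors certify the PER-STAR received sum `Σ_y K(s; y → x) ≤ ρ`, under which Föllmer's super-solution
argument gives the GEOMETRIC rate `ρ^{L₀}` (Literature `DobrushinShlosmanKernelGeometric.lean`, this seat:
`|∫F dγ_Λ(·|ω) − ∫F dγ_Λ(·|η)| ≤ R ρ^{L₀} Σ δ`, consistency of the specification in place of DLR). This file re-runs the
boundary half of «C-KMIX-STAR» through it, with the depth profile `⌊φ/(D+2)⌋` of `StarBoundaryDecayZd.lean` unchanged: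
* `abs_kernel_sub_kernel_le_of_starArray_geometric` — door level, any `ℤ^d` star array with per-star sum `≤ ρ < 1`:
  `|∫F dγ_{Λ₀}(·|ω) − ∫F dγ_{Λ₀}(·|η)| ≤ (2√N) ρ^{⌊m/(D+2)⌋} Σ_Δ δ` (was `2(2√N) e^{−starRate·⌊m/(D+2)⌋}`);
* `abs_kernel_sub_integral_le_of_starArray_geometric`, `abs_kernel_sub_integral_le_of_starWindowBoundZd_geometric` — against
  every Gibbs measure; through ds-1's Wilson door;
* ★★★ `su2_wilson_boundary_star_geometric` — `SU(2)`, `d = 4`, EVERY `0 ≤ β_W ≤ 9/25`, hypothesis-free: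
  `|∫F dγ_{Λ₀}(·|η) − ∫F dμ| ≤ 2√2 · K · #Δ · R_G(β_W)^{⌊m/4⌋}`; `su2_wilson_box_star_geometric` — boxes.
Since `starRate 4 ρ ≤ (1−ρ)²/2 ≤ −log ρ` on `0 < ρ < 1`, every bound here is at least as sharp as its `StarBoundaryDecayZd`
twin, with half the constant; near the frontier `β_W = 9/25` (`ρ = R_G` within `3·10⁻³` of `1`) both rates are tiny.
WHAT THIS IS NOT: strong-coupling LATTICE statements about finite-volume kernels of the Wilson action; nothing about the
continuum limit or the Clay Millennium problem. The companion for Gibbs states (no boundary field) at the geometric rate is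
rb-p1's `StarDoorZdGeometric.lean`.

References: H. Föllmer, LNM 1362 (1988) Ch. I (2.7)–(2.10), Thm. (2.8); R. L. Dobrushin, S. B. Shlosman (1985), Thm. 1;
H.-O. Georgii (2011) §8.2; the Literature's `DobrushinShlosmanKernelGeometric.lean`, `DobrushinShlosmanSuperSolutionInfiniteVolume.lean`;
this seat's `StarBoundaryDecayZd.lean` (followed line by line); rb-p1's `StarDoorZdGeometric.lean`.
-/

noncomputable section

open MeasureTheory ProbabilityTheory Function Finset Real
open scoped NNReal
open Literature.Probability.LatticeModels
open Literature.Probability.LatticeModels.DobrushinMetric (IsLipBound integrable_of_abs_le')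
open Literature.MathematicalPhysics.QuantumLattice
open Literature.MathematicalPhysics.QuantumFieldTheory (suFrobDist suFrobDist_nonneg suFrobDist_le
  suFrobDist_self suEntries dist_suEntries_le_suFrobDist IsLipschitzCylinder isSpecification_ymSpecification_of_t2Space)
open Summit.Ventures.YMGap.DSWindowZd
open Summit.Ventures.YMGap.StarWindowGauge (gaugeR gaugeR_lt_one_of_le)
open Summit.Ventures.YMGap.StarLemmaG (starWindowBound_lemmaG gaugeR_nonneg)

namespace Summit.Ventures.YMGap.RobustBall

variable {d N : ℕ}

/-! ### Door level: two boundary fields, and every Gibbs measure, geometric rate -/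

/-- ★★ **A FINITE VOLUME FORGETS ITS BOUNDARY FIELD THROUGH A `ℤ^d` STAR DOOR.** Let `γ` be a specification on the links of `ℤ^d` with
`SU(N)` spins (`IsSpecification`) whose star kernels are quasilocal with locality sets `nbhd c ⊇ starWinZd c` of radius `D ≥ 1`, carrying a
star array `K ≥ 0` supported in the locality sets with the sitewise window contraction (H1) for the Frobenius weight and per-star received sum
`≤ ρ < 1`. Then for every finite link volume `Λ₀`, ANY TWO boundary fields `ω, η`, every depth function `φ` of `Λ₀` and every bounded
measurable `F` on links `Δ ⊆ Λ₀` (`φ ≥ m` on `Δ`) with Frobenius-Lipschitz vector `δ`: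
`|∫F dγ_{Λ₀}(·|ω) − ∫F dγ_{Λ₀}(·|η)| ≤ (2√N) ρ^{⌊m/(D+2)⌋} Σ_{x ∈ Δ} δ x` — the GEOMETRIC rate of Föllmer's super-solution
argument under the per-star received sum (Literature `DobrushinShlosman.abs_integral_sub_integral_le_of_window_geometric` with the
depth profile of `StarBoundaryDecayZd.lean`); compare `abs_kernel_sub_kernel_le_of_starArray` (rate `starRate d ρ`, constant `2(2√N)`). [folklore] -/
theorem abs_kernel_sub_kernel_le_of_starArray_geometric {γ : Specification (ZdEdge d) (SUN N)} (hγ : IsSpecification γ)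
    {D : ℕ} (hD : 1 ≤ D) {nbhd : ZdEdge d → Finset (ZdEdge d)} (hwin : ∀ c, starWinZd c ⊆ nbhd c)
    (hnbhd : ∀ (c : ZdEdge d), ∀ y ∈ nbhd c, ∀ i, (y.1 i - c.1 i).natAbs ≤ D)
    (hloc : ∀ (c : ZdEdge d) (ζ ζ' : LGConfig d (SUN N)), (∀ v ∈ nbhd c, ζ v = ζ' v) →
      ∀ (f : LGConfig d (SUN N) → ℝ), Measurable f → (∃ B, ∀ σ, |f σ| ≤ B) →
        DependsOn f (starWinZd c : Set (ZdEdge d)) →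
        ∫ σ, f σ ∂(γ (starWinZd c) ζ) = ∫ σ, f σ ∂(γ (starWinZd c) ζ'))
    {K : Site d → ZdEdge d → ZdEdge d → ℝ} (hK0 : ∀ s y x, 0 ≤ K s y x)
    (hKsupp : ∀ (c : ZdEdge d) (y x : ZdEdge d), K c.1 y x ≠ 0 → y ∈ nbhd c)
    (hcontract : ∀ (c y : ZdEdge d), y ∉ starWinZd c →
      ∀ (ω η : LGConfig d (SUN N)), (∀ v, v ≠ y → ω v = η v) →
      ∀ (f : LGConfig d (SUN N) → ℝ) (δ : ZdEdge d → ℝ),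
        Measurable f → (∃ B, ∀ σ, |f σ| ≤ B) → DependsOn f (starWinZd c : Set (ZdEdge d)) →
        (∀ x, 0 ≤ δ x) →
        (∀ (x : ZdEdge d) (σ τ : LGConfig d (SUN N)), (∀ v, v ≠ x → σ v = τ v) →
          |f σ - f τ| ≤ δ x * suFrobDist (σ x) (τ x)) →
          |∫ σ, f σ ∂(γ (starWinZd c) ω) - ∫ σ, f σ ∂(γ (starWinZd c) η)| ≤
            (∑ x ∈ starWinZd c, K c.1 y x * δ x) * suFrobDist (ω y) (η y))
    {ρ : ℝ} (hρ0 : 0 ≤ ρ) (hρ1 : ρ < 1) (hsum : ∀ (c : ZdEdge d), ∀ x ∈ starWinZd c, ∑ y ∈ nbhd c, K c.1 y x ≤ ρ)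
    (Λ₀ : Finset (ZdEdge d)) (ω η : LGConfig d (SUN N)) (φ : ZdEdge d → ℝ)
    (hφ : ∀ x y : ZdEdge d, φ x ≤ φ y + ‖x.1 - y.1‖) (hφΛ : ∀ x, 0 < φ x → x ∈ Λ₀)
    {F : LGConfig d (SUN N) → ℝ} (hFm : Measurable F) {B : ℝ} (hB : ∀ σ, |F σ| ≤ B) {Δ : Finset (ZdEdge d)}
    (hFdep : DependsOn F (Δ : Set (ZdEdge d))) {δ : ZdEdge d → ℝ} (hδ : IsLipBound suFrobDist F δ)
    (hΔ : Δ ⊆ Λ₀) {m : ℝ} (hm : ∀ x ∈ Δ, m ≤ φ x) :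
    |∫ σ, F σ ∂(γ Λ₀ ω) - ∫ σ, F σ ∂(γ Λ₀ η)| ≤
      2 * Real.sqrt N * ρ ^ ⌊m / (D + 2 : ℕ)⌋₊ * ∑ x ∈ Δ, δ x := by
  classical
  have hR₀ : (0 : ℝ) ≤ 2 * Real.sqrt N := by positivity
  obtain ⟨ℓ, hU, hℓ, hL⟩ := exists_starDepthProfile hD hnbhd K hKsupp Λ₀ Δ φ hφ hφΛ hm
  have hFdepΛ : DependsOn F (Λ₀ : Set (ZdEdge d)) :=
    hFdep.mono fun v hv => Finset.mem_coe.2 (hΔ (Finset.mem_coe.1 hv))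
  have hδL : ∀ x, ℓ x < ⌊m / (D + 2 : ℕ)⌋₊ → (fun x => if x ∈ Δ then δ x else 0) x = 0 := fun x hx => by
    dsimp only
    split_ifs with hxΔ
    · exact absurd (hL x hxΔ) (not_le.2 hx)
    · rfl
  have key := DobrushinShlosman.abs_integral_sub_integral_le_of_window_geometric hγ suFrobDist_nonneg suFrobDist_le
    hR₀ (win := starWinZd) (nbhd := nbhd) (K := fun c => K c.1) (fun c y x => hK0 _ _ _)
    self_mem_starWinZd hwin (fun c y x => hKsupp c y x) hcontract hloc hρ0 hρ1 (fun c x hx => hsum c x hx)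
    Λ₀ ω η ℓ _ hU hℓ hFm hB hFdepΛ (hδ.restrict hFdep) hδL
  have hs : ∑ x ∈ Λ₀, (if x ∈ Δ then δ x else 0) = ∑ x ∈ Δ, δ x := by
    rw [Finset.sum_ite_mem, Finset.inter_eq_right.2 hΔ]
  rw [hs] at key
  exact key

/-- **Against every Gibbs measure** (DLR: `∫F dμ = ∫ γ_{Λ₀}(F|ω) dμ(ω)`): under the hypotheses of `abs_kernel_sub_kernel_le_of_starArray_geometric`,
for every Gibbs measure `μ` of `γ`, every finite `Λ₀`, EVERY boundary field `η`:
`|∫F dγ_{Λ₀}(·|η) − ∫F dμ| ≤ (2√N) ρ^{⌊m/(D+2)⌋} Σ_{Δ} δ`. [folklore] -/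
theorem abs_kernel_sub_integral_le_of_starArray_geometric {γ : Specification (ZdEdge d) (SUN N)} (hγ : IsSpecification γ)
    {D : ℕ} (hD : 1 ≤ D) {nbhd : ZdEdge d → Finset (ZdEdge d)} (hwin : ∀ c, starWinZd c ⊆ nbhd c)
    (hnbhd : ∀ (c : ZdEdge d), ∀ y ∈ nbhd c, ∀ i, (y.1 i - c.1 i).natAbs ≤ D)
    (hloc : ∀ (c : ZdEdge d) (ζ ζ' : LGConfig d (SUN N)), (∀ v ∈ nbhd c, ζ v = ζ' v) →
      ∀ (f : LGConfig d (SUN N) → ℝ), Measurable f → (∃ B, ∀ σ, |f σ| ≤ B) →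
        DependsOn f (starWinZd c : Set (ZdEdge d)) →
        ∫ σ, f σ ∂(γ (starWinZd c) ζ) = ∫ σ, f σ ∂(γ (starWinZd c) ζ'))
    {K : Site d → ZdEdge d → ZdEdge d → ℝ} (hK0 : ∀ s y x, 0 ≤ K s y x)
    (hKsupp : ∀ (c : ZdEdge d) (y x : ZdEdge d), K c.1 y x ≠ 0 → y ∈ nbhd c)
    (hcontract : ∀ (c y : ZdEdge d), y ∉ starWinZd c →
      ∀ (ω η : LGConfig d (SUN N)), (∀ v, v ≠ y → ω v = η v) →
      ∀ (f : LGConfig d (SUN N) → ℝ) (δ : ZdEdge d → ℝ),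
        Measurable f → (∃ B, ∀ σ, |f σ| ≤ B) → DependsOn f (starWinZd c : Set (ZdEdge d)) →
        (∀ x, 0 ≤ δ x) →
        (∀ (x : ZdEdge d) (σ τ : LGConfig d (SUN N)), (∀ v, v ≠ x → σ v = τ v) →
          |f σ - f τ| ≤ δ x * suFrobDist (σ x) (τ x)) →
          |∫ σ, f σ ∂(γ (starWinZd c) ω) - ∫ σ, f σ ∂(γ (starWinZd c) η)| ≤
            (∑ x ∈ starWinZd c, K c.1 y x * δ x) * suFrobDist (ω y) (η y))
    {ρ : ℝ} (hρ0 : 0 ≤ ρ) (hρ1 : ρ < 1) (hsum : ∀ (c : ZdEdge d), ∀ x ∈ starWinZd c, ∑ y ∈ nbhd c, K c.1 y x ≤ ρ)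
    {μ : Measure (LGConfig d (SUN N))} (hμ : IsGibbsMeasure γ μ)
    (Λ₀ : Finset (ZdEdge d)) (η : LGConfig d (SUN N)) (φ : ZdEdge d → ℝ)
    (hφ : ∀ x y : ZdEdge d, φ x ≤ φ y + ‖x.1 - y.1‖) (hφΛ : ∀ x, 0 < φ x → x ∈ Λ₀)
    {F : LGConfig d (SUN N) → ℝ} (hFm : Measurable F) {B : ℝ} (hB : ∀ σ, |F σ| ≤ B) {Δ : Finset (ZdEdge d)}
    (hFdep : DependsOn F (Δ : Set (ZdEdge d))) {δ : ZdEdge d → ℝ} (hδ : IsLipBound suFrobDist F δ)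
    (hΔ : Δ ⊆ Λ₀) {m : ℝ} (hm : ∀ x ∈ Δ, m ≤ φ x) :
    |(∫ σ, F σ ∂(γ Λ₀ η)) - ∫ σ, F σ ∂μ| ≤
      2 * Real.sqrt N * ρ ^ ⌊m / (D + 2 : ℕ)⌋₊ * ∑ x ∈ Δ, δ x := by
  haveI := hμ.isProbabilityMeasure
  set C : ℝ := 2 * Real.sqrt N * ρ ^ ⌊m / (D + 2 : ℕ)⌋₊ * ∑ x ∈ Δ, δ x with hC
  have hpt : ∀ ω, |(∫ σ, F σ ∂(γ Λ₀ η)) - ∫ σ, F σ ∂(γ Λ₀ ω)| ≤ C := fun ω =>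
    abs_kernel_sub_kernel_le_of_starArray_geometric hγ hD hwin hnbhd hloc hK0 hKsupp hcontract hρ0 hρ1 hsum Λ₀ η ω φ hφ hφΛ hFm hB hFdep hδ hΔ hm
  have hgm : Measurable fun ω => ∫ σ, F σ ∂(γ Λ₀ ω) := DobrushinShlosman.measurable_windowAvg' hγ Λ₀ hFm
  have hgB : ∀ ω, |∫ σ, F σ ∂(γ Λ₀ ω)| ≤ B := fun ω => DobrushinShlosman.abs_windowAvg_le' hγ Λ₀ hB ω
  have hgi : Integrable (fun ω => ∫ σ, F σ ∂(γ Λ₀ ω)) μ := integrable_of_abs_le' hgm hgB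
  have hDLR : ∫ σ, F σ ∂μ = ∫ ω, ∫ σ, F σ ∂(γ Λ₀ ω) ∂μ :=
    (hμ.integral_integral_eq hγ Λ₀ (integrable_of_abs_le' hFm hB)).symm
  rw [hDLR]
  have h1 : (∫ σ, F σ ∂(γ Λ₀ η)) - ∫ ω, ∫ σ, F σ ∂(γ Λ₀ ω) ∂μ =
      ∫ ω, ((∫ σ, F σ ∂(γ Λ₀ η)) - ∫ σ, F σ ∂(γ Λ₀ ω)) ∂μ := by
    rw [integral_sub (integrable_const _) hgi, integral_const, smul_eq_mul, probReal_univ, one_mul]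
  rw [h1]
  calc |∫ ω, ((∫ σ, F σ ∂(γ Λ₀ η)) - ∫ σ, F σ ∂(γ Λ₀ ω)) ∂μ|
      ≤ ∫ ω, |(∫ σ, F σ ∂(γ Λ₀ η)) - ∫ σ, F σ ∂(γ Λ₀ ω)| ∂μ := abs_integral_le_integral_abs
    _ ≤ ∫ _ω, C ∂μ := integral_mono_of_nonneg (ae_of_all _ fun ω => abs_nonneg _) (integrable_const C)
        (ae_of_all _ hpt)
    _ = C := by simp

/-- **Through ds-1's Wilson star door `StarWindowBoundZd d N β ρ suFrobDist`** (Wilson action at bare coupling `β`, locality sets `starNbhdZd`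
of radius `2`, quasilocality by `dependsOn_integral_ymSpecification`): for every Gibbs measure `μ`, every finite `Λ₀`, EVERY boundary field `η`,
every depth function `φ` of `Λ₀`: `|∫F dγ_{Λ₀}(·|η) − ∫F dμ| ≤ (2√N) ρ^{⌊m/4⌋} Σ_{Δ} δ`. [folklore] -/
theorem abs_kernel_sub_integral_le_of_starWindowBoundZd_geometric {β ρ : ℝ} (hρ0 : 0 ≤ ρ) (hρ1 : ρ < 1)
    (h : StarWindowBoundZd d N β ρ suFrobDist)
    {μ : Measure (LGConfig d (SUN N))} (hμ : IsGibbsMeasure (ymSpecification (d := d) (fundamentalRep (Fin N)) β) μ)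
    (Λ₀ : Finset (ZdEdge d)) (η : LGConfig d (SUN N)) (φ : ZdEdge d → ℝ)
    (hφ : ∀ x y : ZdEdge d, φ x ≤ φ y + ‖x.1 - y.1‖) (hφΛ : ∀ x, 0 < φ x → x ∈ Λ₀)
    {F : LGConfig d (SUN N) → ℝ} (hFm : Measurable F) {B : ℝ} (hB : ∀ σ, |F σ| ≤ B) {Δ : Finset (ZdEdge d)}
    (hFdep : DependsOn F (Δ : Set (ZdEdge d))) {δ : ZdEdge d → ℝ} (hδ : IsLipBound suFrobDist F δ)
    (hΔ : Δ ⊆ Λ₀) {m : ℝ} (hm : ∀ x ∈ Δ, m ≤ φ x) :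
    |(∫ σ, F σ ∂(ymSpecification (d := d) (fundamentalRep (Fin N)) β Λ₀ η)) - ∫ σ, F σ ∂μ| ≤
      2 * Real.sqrt N * ρ ^ ⌊m / (2 + 2 : ℕ)⌋₊ * ∑ x ∈ Δ, δ x := by
  classical
  haveI : SecondCountableTopology (Matrix (Fin N) (Fin N) ℂ) :=
    inferInstanceAs (SecondCountableTopology (Fin N → Fin N → ℂ))
  haveI : SecondCountableTopology (SUN N) := Topology.IsEmbedding.subtypeVal.secondCountableTopology
  have hγ : IsSpecification (ymSpecification (d := d) (fundamentalRep (Fin N)) β) :=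
    isSpecification_ymSpecification_of_t2Space _ (continuous_fundamentalRep (Fin N)) _
  obtain ⟨K, hK0, hKsupp, hcontract, hsum⟩ := h
  have hloc : ∀ (c : ZdEdge d) (ζ ζ' : LGConfig d (SUN N)), (∀ v ∈ starNbhdZd c.1, ζ v = ζ' v) →
      ∀ (f : LGConfig d (SUN N) → ℝ), Measurable f → (∃ B, ∀ σ, |f σ| ≤ B) →
        DependsOn f (starWinZd c : Set (ZdEdge d)) →
        ∫ σ, f σ ∂(ymSpecification (d := d) (fundamentalRep (Fin N)) β (starWinZd c) ζ) =
          ∫ σ, f σ ∂(ymSpecification (d := d) (fundamentalRep (Fin N)) β (starWinZd c) ζ') := by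
    intro c ζ ζ' hζ f hfm' _ hfdep'
    exact dependsOn_integral_ymSpecification (fundamentalRep (Fin N)) (continuous_fundamentalRep (Fin N))
      β (starWinZd c) hfm' hfdep' fun v hv => hζ v (Finset.mem_coe.1 hv)
  exact abs_kernel_sub_integral_le_of_starArray_geometric hγ (D := 2) (by norm_num) (nbhd := fun c => starNbhdZd c.1)
    (fun c => vertexStarZd_subset_starNbhdZd c.1) (fun c y hy i => natAbs_sub_le_two_of_mem_starNbhdZd hy i) hloc hK0
    (fun c y x h' => hKsupp _ _ _ h') hcontract hρ0 hρ1 (fun c x hx => hsum c.1 x hx) hμ Λ₀ η φ hφ hφΛ hFm hB hFdep hδ hΔ hm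

/-! ### `SU(2)` lattice Yang–Mills on `ℤ⁴` at every `0 ≤ β_W ≤ 9/25`, hypothesis-free, geometric rate -/

/-- ★★★ **`SU(2)`, `d = 4`, WILSON ACTION, EVERY `0 ≤ β_W ≤ 9/25`: A FINITE VOLUME FORGETS ITS BOUNDARY FIELD AT THE GEOMETRIC
STAR RATE `R_G(β_W)^{depth/4}`, HYPOTHESIS-FREE** (tree bare coupling `β_W/2`). For every finite link volume `Λ₀`, EVERY boundary field `η`, EVERY DLR state `μ`, every depth
function `φ` of `Λ₀` (`1`-Lipschitz in the sup-norm of base points, `φ > 0 ⇒ ∈ Λ₀`) and every Lipschitz cylinder `F` (constant `K`, links `Δ ⊆ Λ₀`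
with `φ ≥ m` on `Δ`): `|∫F dγ_{Λ₀}(·|η) − ∫F dμ| ≤ 2√2 · K · #Δ · R_G(β_W)^{⌊m/4⌋}` — Lemma G on the torus of side `5`, the
torus → `ℤ⁴` transfer and the geometric star boundary door above; improves `su2_wilson_boundary_star` (rate
`exp(−starRate 4 (R_G β_W) ⌊m/4⌋)`, `starRate 4 ρ = (1−ρ)²/(2(16ρ+1)) ≤ −log ρ`, constant `4√2`). [folklore] -/
theorem su2_wilson_boundary_star_geometric {βW : ℝ} (h0 : 0 ≤ βW) (h : βW ≤ 9 / 25)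
    {μ : Measure (LGConfig 4 (SUN 2))} (hμ : μ ∈ ymGibbsMeasures (d := 4) (fundamentalRep (Fin 2)) (βW / 2))
    (Λ₀ : Finset (ZdEdge 4)) (η : LGConfig 4 (SUN 2)) (φ : ZdEdge 4 → ℝ)
    (hφ : ∀ x y : ZdEdge 4, φ x ≤ φ y + ‖x.1 - y.1‖) (hφΛ : ∀ x, 0 < φ x → x ∈ Λ₀)
    {F : LGConfig 4 (SUN 2) → ℝ} {Δ : Finset (ZdEdge 4)} {K : ℝ≥0}
    (hF : IsLipschitzCylinder (fundamentalRep (Fin 2)) F Δ K) (hΔ : Δ ⊆ Λ₀) {m : ℝ} (hm : ∀ x ∈ Δ, m ≤ φ x) :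
    |(∫ U, F U ∂(ymSpecification (d := 4) (fundamentalRep (Fin 2)) (βW / 2) Λ₀ η)) - ∫ U, F U ∂μ| ≤
      2 * Real.sqrt 2 * K * Δ.card * gaugeR βW ^ ⌊m / (4 : ℕ)⌋₊ := by
  have hρ0 : 0 ≤ gaugeR βW := gaugeR_nonneg h0 (by linarith)
  have hρ1 : gaugeR βW < 1 := gaugeR_lt_one_of_le h0 h
  have hZd : StarWindowBoundZd 4 2 (βW / 2) (gaugeR βW) suFrobDist :=
    starWindowBoundZd_of_starWindowBound (L := 5) le_rfl suFrobDist_nonneg (starWindowBound_lemmaG (by norm_num) h0 (by linarith))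
  have hA : ∀ a b : SUN 2, dist (suEntries a) (suEntries b) ≤ 1 * suFrobDist a b := fun a b => by
    rw [one_mul]; exact dist_suEntries_le_suFrobDist a b
  have hμ' : IsGibbsMeasure (ymSpecification (d := 4) (fundamentalRep (Fin 2)) (βW / 2)) μ := hμ
  have key := abs_kernel_sub_integral_le_of_starWindowBoundZd_geometric (d := 4) (N := 2) hρ0 hρ1 hZd hμ' Λ₀ η φ hφ hφΛ
    hF.measurable hF.abs_le hF.dependsOn (hF.isLipBound zero_le_one hA) hΔ hm
  have hK : (0 : ℝ) ≤ K := K.2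
  have hsum : ∑ y ∈ Δ, (if y ∈ Δ then 1 * (K : ℝ) else 0) = Δ.card * K := by
    rw [Finset.sum_ite_of_true (fun y hy => hy), Finset.sum_const, nsmul_eq_mul, one_mul]
  have hsq : Real.sqrt ((2 : ℕ) : ℝ) = Real.sqrt 2 := by norm_num
  have h22 : (2 + 2 : ℕ) = 4 := by norm_num
  rw [hsum, hsq, h22] at key
  calc |(∫ U, F U ∂(ymSpecification (d := 4) (fundamentalRep (Fin 2)) (βW / 2) Λ₀ η)) - ∫ U, F U ∂μ|
      ≤ 2 * Real.sqrt 2 * gaugeR βW ^ ⌊m / (4 : ℕ)⌋₊ * (Δ.card * K) := key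
    _ = 2 * Real.sqrt 2 * K * Δ.card * gaugeR βW ^ ⌊m / (4 : ℕ)⌋₊ := by ring

/-- **Boxes, `SU(2)`, `d = 4`, `0 ≤ β_W ≤ 9/25`**: for the volume `Λ₀ =` links based in `box 4 M`, EVERY boundary field `η` on it, EVERY DLR state `μ`
and a Lipschitz cylinder `F` on links based in `box 4 M'`, `M' ≤ M`:
`|∫F dγ_{box M}(·|η) − ∫F dμ| ≤ 2√2 · K · #Δ · R_G(β_W)^{⌊(M + 1 − M')/4⌋}` — the thermodynamic limit along boxes at the
GEOMETRIC star rate, UNIFORMLY IN THE BOUNDARY FIELD, on the whole vertex-star window (depth function `M + 1 − ‖x.1‖_∞`). [folklore] -/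
theorem su2_wilson_box_star_geometric {βW : ℝ} (h0 : 0 ≤ βW) (h : βW ≤ 9 / 25) {M M' : ℕ} (hMM : M' ≤ M)
    {μ : Measure (LGConfig 4 (SUN 2))} (hμ : μ ∈ ymGibbsMeasures (d := 4) (fundamentalRep (Fin 2)) (βW / 2))
    (η : LGConfig 4 (SUN 2)) {F : LGConfig 4 (SUN 2) → ℝ} {Δ : Finset (ZdEdge 4)} {K : ℝ≥0}
    (hF : IsLipschitzCylinder (fundamentalRep (Fin 2)) F Δ K) (hΔ : Δ ⊆ (box 4 M') ×ˢ (Finset.univ : Finset (Fin 4))) :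
    |(∫ U, F U ∂(ymSpecification (d := 4) (fundamentalRep (Fin 2)) (βW / 2)
        ((box 4 M) ×ˢ (Finset.univ : Finset (Fin 4))) η)) - ∫ U, F U ∂μ| ≤
      2 * Real.sqrt 2 * K * Δ.card * gaugeR βW ^ ⌊((M : ℝ) + 1 - M') / (4 : ℕ)⌋₊ := by
  classical
  have hΔ' : Δ ⊆ (box 4 M) ×ˢ (Finset.univ : Finset (Fin 4)) := fun x hx => by
    have h1 := Finset.mem_product.1 (hΔ hx)
    refine Finset.mem_product.2 ⟨mem_box.2 fun i => ?_, Finset.mem_univ _⟩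
    have := (mem_box.1 h1.1) i
    omega
  refine su2_wilson_boundary_star_geometric h0 h hμ _ η (fun x => (M : ℝ) + 1 - supNormZd x.1)
    (fun x y => ?_) (fun x hx => ?_) hF hΔ' (fun x hx => ?_)
  · have h1 := supNormZd_le_supNormZd_add_norm y.1 x.1
    rw [norm_sub_rev] at h1
    linarith
  · refine Finset.mem_product.2 ⟨mem_box.2 fun i => ?_, Finset.mem_univ _⟩
    have h1 : (supNormZd x.1 : ℝ) < M + 1 := by linarith
    have h1' : supNormZd x.1 < M + 1 := by exact_mod_cast h1
    have h2 : supNormZd x.1 ≤ M := Nat.lt_succ_iff.1 h1'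
    have h3 := natAbs_le_supNormZd x.1 i
    omega
  · have h1 := Finset.mem_product.1 (hΔ hx)
    have h2 : supNormZd x.1 ≤ M' := supNormZd_le_iff.2 fun i => by
      have := (mem_box.1 h1.1) i
      omega
    have h3 : (supNormZd x.1 : ℝ) ≤ M' := by exact_mod_cast h2
    linarith

end Summit.Ventures.YMGap.RobustBall

end
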